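import Summits.Ventures.QEC.CircuitDistance.PortXTable
import Summits.Ventures.QEC.CircuitDistance.PortBridge
import HarnessLib

/-!
# P3-PORT (E4): the `X`-SECTOR THEOREM — tables + covered UNSAT leaves + orbit-complete word list ⇒ no undetectable
# `X`-logical fault set of `≤ w` operations in the `N₀`-cycle circuit (cell `qec`, experiment CDX, seat qec-cdx-type-1)

* `xSymm`: translations `t ∈ ℤ_ℓ × ℤ_m` as a `Fibre.Symmetry` of the `X`-sector DEM (from `run1_translate`);
* `LeafEntry` (word in group order + `Fibre.Leaf`), the DECIDABLE coverage checker `XTable.covers` and its soundness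
  `covers_sound` (⇒ `Fibre.Covers`), `silent_xDEM` (undetectable ⇒ silent);
* **`no_xLogical_of_leaves`** and the sector assembly **`not_hasAt_of_sectors`** (T4 at the level of the predicates).
Nothing here asserts a value of `d_circ`.
-/

namespace Summit.Ventures.QEC.CircuitDistance

open Literature.InformationTheory.QuantumCodes

variable {ℓ m : ℕ}

/-- A LEAF ENTRY: the word (generator supports, in the leaf's group order) with its leaf data. -/
structure LeafEntry (ℓ m : ℕ) where
  /-- the word, one generator support per coordinate group -/
  word : List (Finset (BB.Mono ℓ m ⊕ BB.Mono ℓ m))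
  /-- the leaf data -/
  leaf : Fibre.Leaf

variable [NeZero ℓ] [NeZero m]

/-! ## Translations as symmetries of the `X`-sector DEM -/

omit [NeZero ℓ] [NeZero m] in
/-- Translating twice. -/
theorem Fault.translate_translate [NeZero ℓ] [NeZero m] (f : Fault ℓ m) (a b : BB.Mono ℓ m) :
    (f.translate a).translate b = f.translate (a + b) := by
  cases f <;> simp [Fault.translate, add_assoc]

omit [NeZero ℓ] [NeZero m] in
/-- Translating by `0`. -/
theorem Fault.translate_zero [NeZero ℓ] [NeZero m] (f : Fault ℓ m) : f.translate 0 = f := by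
  cases f <;> simp [Fault.translate]

/-- Translation of faults as a bijection. -/
def faultTranslateEquiv (t : BB.Mono ℓ m) : Fault ℓ m ≃ Fault ℓ m where
  toFun := Fault.translate t
  invFun := Fault.translate (-t)
  left_inv f := by simp [Fault.translate_translate, Fault.translate_zero]
  right_inv f := by simp [Fault.translate_translate, Fault.translate_zero]

/-- Translation of detectors `(layer, check)`. -/
def detTranslateEquiv (t : BB.Mono ℓ m) : (ℕ × BB.Mono ℓ m) ≃ (ℕ × BB.Mono ℓ m) :=
  Equiv.prodCongr (Equiv.refl ℕ) (Equiv.addRight t)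

/-- Translation of generator supports. -/
def genTranslateEquiv (t : BB.Mono ℓ m) : Finset (BB.Mono ℓ m ⊕ BB.Mono ℓ m) ≃ Finset (BB.Mono ℓ m ⊕ BB.Mono ℓ m) :=
  Equiv.finsetCongr (BB.Code.translate t)

/-- `genTranslateEquiv t` is `trQ t`. -/
theorem genTranslateEquiv_apply (t : BB.Mono ℓ m) (s : Finset (BB.Mono ℓ m ⊕ BB.Mono ℓ m)) :
    genTranslateEquiv t s = trQ t s := rfl

/-- Translated `X`-columns. -/
theorem xDet_translate (S : SMCode ℓ m) (Nc : ℕ) (f : Fault ℓ m) (t : BB.Mono ℓ m) :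
    xDet S Nc (f.translate t) = (xDet S Nc f).map (detTranslateEquiv t).toEmbedding := by
  ext ⟨s, j⟩
  rw [Finset.mem_map_equiv]
  have hsymm : (detTranslateEquiv t).symm (s, j) = (s, j + -t) := rfl
  rw [hsymm]
  simp only [xDet, Finset.mem_filter, Finset.mem_product, Finset.mem_range, Finset.mem_univ, and_true,
    detZ_translate_singleton, sub_eq_add_neg]

/-- **Translations are symmetries of the `X`-sector DEM.** -/
def xSymm (S : SMCode ℓ m) (T : XTable ℓ m) (Nc : ℕ) (t : BB.Mono ℓ m) : Fibre.Symmetry (xDEM S T Nc) (scope Nc) where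
  onCol := faultTranslateEquiv t
  onDet := detTranslateEquiv t
  onGen := genTranslateEquiv t
  det_map f := xDet_translate S Nc f t
  cls_map f := by
    show ((f.translate t).xKind.bind fun ki => (T.cls ki.1).map (trQ ki.2)) =
      (f.xKind.bind fun ki => (T.cls ki.1).map (trQ ki.2)).map (genTranslateEquiv t)
    rw [Fault.xKind_translate]
    rcases f.xKind with _ | ⟨k, i⟩
    · rfl
    · simp only [Option.map_some, Option.bind_some, Option.map_map]
      cases T.cls k with
      | none => rfl
      | some g => simp only [Option.map_some, Function.comp, genTranslateEquiv_apply, trQ_add]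
  scope_map f := by
    show (1 ≤ (f.translate t).cyc ∧ (f.translate t).cyc ≤ Nc) ↔ (1 ≤ f.cyc ∧ f.cyc ≤ Nc)
    rw [Fault.cyc_translate]

/-! ## Coverage -/

/-- DECIDABLE COVERAGE CHECK of a leaf entry against the table: every kind / base index / cycle of the `Nc`-circuit whose
class is the `j`-th generator of the word has its fast column (encoded) among group `j`'s coordinates; every null kind
has an empty column or one among the null coordinates; and the word has one generator per group. -/
def XTable.covers (S : SMCode ℓ m) (T : XTable ℓ m) (Nc : ℕ) (e : LeafEntry ℓ m) : Bool :=
  decide (e.word.length = e.leaf.k) &&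
  (XKind.all.product (monoList ℓ m)).all fun ki =>
    match (T.cls ki.1).map (trQ ki.2) with
    | none => (List.range Nc).all fun c0 =>
        decide ((T.detFast S Nc ki.1 ki.2 (c0 + 1)).image encDet = ∅) ||
          e.leaf.nulls.any fun c => decide ((e.leaf.coordsOf c).toFinset = (T.detFast S Nc ki.1 ki.2 (c0 + 1)).image encDet)
    | some g => (List.range e.word.length).all fun j =>
        !decide (e.word[j]? = some g) ||
          (List.range Nc).all fun c0 =>
            (e.leaf.group j).any fun c => decide ((e.leaf.coordsOf c).toFinset = (T.detFast S Nc ki.1 ki.2 (c0 + 1)).image encDet)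

/-- The `X`-column of a fault equals that of its representative. -/
theorem xDet_eq_of_xKind (S : SMCode ℓ m) (Nc : ℕ) (f : Fault ℓ m) {k : XKind} {i : BB.Mono ℓ m}
    (h : f.xKind = some (k, i)) : xDet S Nc f = xDet S Nc (k.fault f.cyc i) := by
  unfold xDet; congr 1; funext p; rw [(xColumn_eq_of_xKind S Nc f h).1]

/-- A fault without `X`-part has an empty `X`-column. -/
theorem xDet_eq_empty_of_xKind (S : SMCode ℓ m) (Nc : ℕ) (f : Fault ℓ m) (h : f.xKind = none) : xDet S Nc f = ∅ := by
  unfold xDet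
  rw [Finset.filter_eq_empty_iff]
  intro p _
  rw [(xColumn_zero_of_xKind S Nc f h).1]
  exact Bool.false_ne_true

/-- **Coverage soundness.** A passed coverage check is `Fibre.Covers` for the `X`-sector DEM. -/
theorem covers_sound (S : SMCode ℓ m) (T : XTable ℓ m) (hS : T.ShapeCorrect S) (Nc : ℕ) (e : LeafEntry ℓ m)
    (h : T.covers S Nc e = true) : Fibre.Covers (xDEM S T Nc) (scope Nc) encDet e.word e.leaf := by
  unfold XTable.covers at h
  simp only [Bool.and_eq_true, decide_eq_true_eq, List.all_eq_true] at h
  obtain ⟨hlen, hall⟩ := h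
  refine ⟨encDet_injective, hlen, fun f hf j hcls => ?_, fun f hf hcls => ?_⟩
  · obtain ⟨h₁, h₂⟩ := hf
    change (f.xKind.bind fun ki => (T.cls ki.1).map (trQ ki.2)) = some e.word[j] at hcls
    rcases hk : f.xKind with _ | ⟨k, i⟩
    · rw [hk] at hcls; simp at hcls
    · rw [hk, Option.bind_some] at hcls
      have hmem : (k, i) ∈ XKind.all.product (monoList ℓ m) :=
        List.pair_mem_product.2 ⟨XKind.mem_all k (fun lay => Fault.xKind_ne_zero hk lay), mem_monoList i⟩
      have hki := hall (k, i) hmem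
      simp only [hcls] at hki
      rw [List.all_eq_true] at hki
      have hj := hki j (List.mem_range.2 j.2)
      simp only [Bool.or_eq_true, Bool.not_eq_true', decide_eq_false_iff_not, List.all_eq_true, List.any_eq_true,
        decide_eq_true_eq] at hj
      rcases hj with hj | hj
      · exact absurd (List.getElem?_eq_getElem j.2) hj
      · obtain ⟨c, hc, hcc⟩ := hj (f.cyc - 1) (List.mem_range.2 (by omega))
        refine ⟨c, hc, ?_⟩
        rw [hcc, Nat.sub_add_cancel h₁, XTable.detFast_eq_xDet (hS k (XKind.mem_all k (fun lay => Fault.xKind_ne_zero hk lay)))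
          Nc i f.cyc h₁ h₂, ← xDet_eq_of_xKind S Nc f hk]
        rfl
  · obtain ⟨h₁, h₂⟩ := hf
    change (f.xKind.bind fun ki => (T.cls ki.1).map (trQ ki.2)) = none at hcls
    rcases hk : f.xKind with _ | ⟨k, i⟩
    · exact Or.inl (xDet_eq_empty_of_xKind S Nc f hk)
    · rw [hk, Option.bind_some] at hcls
      have hkall : k ∈ XKind.all := XKind.mem_all k (fun lay => Fault.xKind_ne_zero hk lay)
      have hmem : (k, i) ∈ XKind.all.product (monoList ℓ m) := List.pair_mem_product.2 ⟨hkall, mem_monoList i⟩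
      have hki := hall (k, i) hmem
      simp only [hcls] at hki
      rw [List.all_eq_true] at hki
      have hc := hki (f.cyc - 1) (List.mem_range.2 (by omega))
      simp only [Bool.or_eq_true, decide_eq_true_eq, List.any_eq_true] at hc
      have hcol : (T.detFast S Nc k i (f.cyc - 1 + 1)).image encDet = (xDet S Nc f).image encDet := by
        rw [Nat.sub_add_cancel h₁, XTable.detFast_eq_xDet (hS k hkall) Nc i f.cyc h₁ h₂, ← xDet_eq_of_xKind S Nc f hk]
      rcases hc with hc | ⟨c, hcn, hcc⟩
      · left
        rw [hcol, Finset.image_eq_empty] at hc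
        exact hc
      · right
        exact ⟨c, hcn, by rw [hcc, hcol]; rfl⟩

/-! ## Silence -/

/-- An undetectable fault set is silent in the `X`-sector DEM. -/
theorem silent_xDEM (S : SMCode ℓ m) (T : XTable ℓ m) (Nc : ℕ) (F : Finset (Fault ℓ m)) (hU : Undetectable S Nc F) :
    Fibre.Silent (xDEM S T Nc) F := by
  intro d
  obtain ⟨s, j⟩ := d
  show Even ((F.filter fun f => (s, j) ∈ xDet S Nc f).card)
  have hdet := (hU.2 (s + 1) j).2
  rw [detZ_eq_bsum] at hdet
  unfold bsum at hdet
  have hfilt : (F.filter fun f => (s, j) ∈ xDet S Nc f) = F.filter fun f => s < Nc + 2 ∧ detZ S Nc {f} (s + 1) j = true := by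
    apply Finset.filter_congr
    intro f _
    simp [xDet]
  rw [hfilt]
  by_cases hs : s < Nc + 2
  · simp only [hs, true_and]
    rw [Nat.even_iff]
    rcases Nat.mod_two_eq_zero_or_one (F.filter fun f => detZ S Nc {f} (s + 1) j = true).card with h0 | h1
    · exact h0
    · rw [h1] at hdet; simp at hdet
  · have : (F.filter fun f => s < Nc + 2 ∧ detZ S Nc {f} (s + 1) j = true) = ∅ :=
      Finset.filter_eq_empty_iff.2 (fun f _ h => hs h.1)
    rw [this, Finset.card_empty]
    exact ⟨0, rfl⟩

/-! ## The sector theorem -/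

/-- `X`-nontriviality is invariant under adding an `X`-stabiliser. -/
theorem xNontrivial_add_stab (S : SMCode ℓ m) (v s : BB.Mono ℓ m ⊕ BB.Mono ℓ m → ZMod 2)
    (hs : s ∈ rowSpace S.toCode.HX) : XNontrivial S (v + s) ↔ XNontrivial S v := by
  have hker : S.toCode.HZ.mulVec s = 0 := by
    have := CSSCode.rowSpX_le_kerZ S.toCode.css hs
    exact this
  unfold XNontrivial
  rw [Matrix.mulVec_add, hker, add_zero]
  constructor
  · rintro ⟨h1, h2⟩; exact ⟨h1, fun hv => h2 (Submodule.add_mem _ hv hs)⟩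
  · rintro ⟨h1, h2⟩
    refine ⟨h1, fun hv => h2 ?_⟩
    have := Submodule.sub_mem _ hv hs
    rwa [add_sub_cancel_right] at this

/-- **`X`-SECTOR THEOREM.** Tables correct; every listed leaf well-formed, covered and UNSAT with weight `w` and budget
`≤ 1`; the list COMPLETE up to translation for `X`-nontrivial words of weight `≤ w` ⇒ no undetectable fault set of `≤ w`
operations of the `N₀`-cycle circuit has an `X`-nontrivial residual. -/
theorem no_xLogical_of_leaves (S : SMCode ℓ m) (T : XTable ℓ m) (hS : T.ShapeCorrect S) (hC : T.ClassCorrect S)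
    (N₀ w : ℕ) (leaves : List (LeafEntry ℓ m))
    (hwf : ∀ e ∈ leaves, e.leaf.wf = true ∧ T.covers S N₀ e = true ∧ e.word.Nodup ∧
      e.leaf.w = w ∧ e.leaf.budget ≤ 1 ∧
      (Census.CNFEncode.cnfEncodeAny e.leaf.n e.leaf.rows e.leaf.us e.leaf.w).Unsat)
    (hcomplete : ∀ x : Finset (Finset (BB.Mono ℓ m ⊕ BB.Mono ℓ m)), XNontrivial S (∑ g ∈ x, indic g) → x.card ≤ w →
      ∃ e ∈ leaves, ∃ t : BB.Mono ℓ m, x = (e.word.map (trQ t)).toFinset) :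
    ¬ ∃ F : Finset (Fault ℓ m), Undetectable S N₀ F ∧ dataX S N₀ F ∉ rowSpace S.toCode.HX ∧ faultCount F ≤ w := by
  classical
  rintro ⟨F, hU, hL, hw⟩
  -- reduce to one fault per operation
  obtain ⟨F₁, hR, hcard, himg, hX, hZ, hdX, hdZ⟩ := exists_reduced S N₀ F
  have hU₁ : Undetectable S N₀ F₁ := by
    refine ⟨fun f' hf' => ?_, fun t i => ⟨?_, ?_⟩⟩
    · have : f'.loc ∈ F.image Fault.loc := himg (Finset.mem_image_of_mem _ hf')
      obtain ⟨f, hf, hfl⟩ := Finset.mem_image.1 this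
      rw [← Fault.ev_eq_of_loc_eq hfl]; exact hU.1 f hf
    · rw [hX]; exact (hU.2 t i).1
    · rw [hZ]; exact (hU.2 t i).2
  have hNT : XNontrivial S (dataX S N₀ F₁) := by
    refine ⟨(residual_syndrome_zero S N₀ F₁ hU₁).1, ?_⟩
    rw [hdX]; exact hL
  have hscope : ∀ f ∈ F₁, f ∈ scope (ℓ := ℓ) (m := m) N₀ := by
    intro f hf
    have := hU₁.1 f hf
    rw [mem_allEvents_iff, Fault.ev_cyc] at this
    exact this
  -- the abstract fibre reduction
  have key := Fibre.no_silent_nontrivial (xDEM S T N₀) (scope N₀) (classHyp_xDEM S T hS hC N₀) (XNontrivial S)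
    (fun v s hs => xNontrivial_add_stab S v s hs) w ?_ F₁ hscope (hcard.trans hw) (silent_xDEM S T N₀ F₁ hU₁)
  · apply key
    show XNontrivial S (∑ f ∈ F₁, dataX S N₀ {f})
    rw [← dataX_eq_sum]; exact hNT
  -- every nontrivial word of weight ≤ w has an UNSAT leaf, up to translation
  intro x hx hxw
  obtain ⟨e, he, t, rfl⟩ := hcomplete x hx hxw
  obtain ⟨hwfe, hcov, hnd, hwe, hb, hunsat⟩ := hwf e he
  have hcovers := covers_sound S T hS N₀ e hcov
  have hlen : e.word.length = e.leaf.k := hcovers.2.1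
  have hmap : (e.word.map (trQ t)).toFinset = e.word.toFinset.map (xSymm S T N₀ t).onGen.toEmbedding := by
    ext g
    simp only [List.mem_toFinset, List.mem_map, Finset.mem_map_equiv]
    show (∃ a, a ∈ e.word ∧ trQ t a = g) ↔ (genTranslateEquiv t).symm g ∈ e.word
    constructor
    · rintro ⟨a, ha, rfl⟩
      have : (genTranslateEquiv t).symm (genTranslateEquiv t a) = a := Equiv.symm_apply_apply _ _
      rw [genTranslateEquiv_apply] at this; rw [this]; exact ha
    · intro hg
      refine ⟨(genTranslateEquiv t).symm g, hg, ?_⟩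
      rw [← genTranslateEquiv_apply, Equiv.apply_symm_apply]
  rw [hmap, Finset.card_map, List.toFinset_card_of_nodup hnd, hlen,
    Fibre.tightRealisable_map_iff (xDEM S T N₀) (scope N₀) (xSymm S T N₀ t)]
  have hbud : w - e.leaf.k = e.leaf.budget := by unfold Fibre.Leaf.budget; rw [hwe]
  rw [hbud]
  exact Fibre.not_tightRealisable_of_leaf (xDEM S T N₀) (scope N₀) encDet e.word hnd e.leaf hcovers hwfe hunsat hb

/-- **Sector assembly (T4 at the level of the predicates).** Both sector exclusions give the weight exclusion. -/
theorem not_hasAt_of_sectors (S : SMCode ℓ m) (N₀ w : ℕ)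
    (hX : ¬ ∃ F : Finset (Fault ℓ m), Undetectable S N₀ F ∧ dataX S N₀ F ∉ rowSpace S.toCode.HX ∧ faultCount F ≤ w)
    (hZ : ¬ ∃ F : Finset (Fault ℓ m), Undetectable S N₀ F ∧ dataZ S N₀ F ∉ rowSpace S.toCode.HZ ∧ faultCount F ≤ w) :
    ¬ HasLogicalFaultOfWeightAtMostAt S N₀ w := by
  rintro ⟨F, hU, hL, hw⟩
  rcases (logicalError_iff S N₀ F).1 hL with h | h
  · exact hX ⟨F, hU, h, hw⟩
  · exact hZ ⟨F, hU, h, hw⟩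

end Summit.Ventures.QEC.CircuitDistance
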